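import Summits.QuantumFields.YangMills.Theorems.IR.BlockedActivityW
import Literature.MathematicalPhysics.QuantumLattice.StrongExpDecayBoundaryInfluenceNonlocal
import HarnessLib

/-!
# Crux `IR` (stmt-QuantumFields-19354), lane B «strong coupling AFTER BLOCKING»: the SINGLE-CELL TILT representation —
# the W-class of record follows from centre-cell RATIO mixing (dictionary, every `β`)

Helper module for item `stmt-QuantumFields-19354` (`--supports`; it closes nothing), lane `ym-19354-onsetsc-p2` (g3).

THE DICTIONARY (every `β`, every compact `G`).  The W-currency class of record `BlockedActivityClassW ρ β b n a`
(`Theorems/IR/BlockedActivityW`, p536391; binder of the supplier target of record `BlockedActivityTypOnsetCalSCWTolG`, owner R119 (1))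
asks, frame by frame, region by region and window datum by window datum, for a blocked local-perturbation representation
`BlockedRepOn ρ β w Y a S` of the kernel expectations of centre observables.  This file shows that such a representation is
supplied by ONE informative cell:

* §1 `isLocalPerturbation_singleCell` ∕ `blockedRepOn_of_tilt` — take `Ω` = the configuration space, `μ` = ANY probability measure,
  `𝓕 0 = ⊤`, `𝓕 c = ⊥` (`c ≠ 0`), `C = {0}`, `obs f = f`, `g σ 0 = ψ_σ − 1`: the finite-range independence axiom of the tree's
  Kotecký–Preiss layer then holds VACUOUSLY (two non-touching cell sets cannot both contain the centre, and `⊥` is independent of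
  everything), so every exact multiplicative-tilt representation `∫ f dγ_σ = ∫ f ψ_σ dμ ∕ ∫ ψ_σ dμ` with `sup |ψ_σ − 1| ≤ a` IS a
  `BlockedRepOn` of radius `a`.  HONEST READING: the non-local W-class carries no polymer ∕ expansion structure beyond the sup-norm
  (RATIO) mixing of the centre cell over the agreement class; the LOCAL class `BlockedRepOnLoc` (`Theorems/IR/BlockedActivityWDecay`,
  p547052: `local_g`) is the one whose large-mesh realisability is a genuine representation question.
* §2 `integral_ymSpecification_eq_div_bcRatio` — the CHANGE-OF-EXTERIOR identity for the Wilson kernels with an ARBITRARY pair of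
  exteriors `σ₁, σ₂` (finite form of Chatterjee 2021 eq. (7.2); the tree's `integral_ymSpecification_update_eq` is the one-link case):
  `∫ F dγ_Λ(·|σ₁) = ∫ F·R dγ_Λ(·|σ₂) ∕ ∫ R dγ_Λ(·|σ₂)` with the boundary Boltzmann ratio `R = bcRatio ρ β Λ σ₁ σ₂`, for every `F`
  not distinguishing the two gluings (both kernels are tilts of ONE glued product Haar measure, Mathlib `tilted_tilted`).
* Part 2∕2 (`Theorems/IR/BlockedActivityWCentreRatio`) CONDITIONS the tilt on the centre cell by the Markov property (tree
  `integral_mul_eq_integral_mul_kernel`): `∫ f dγ_Λ(·|σ) = ∫ f·q dγ_Λ(·|τ) ∕ ∫ q dγ_Λ(·|τ)` with `q = centreRatio ρ β w Y σ τ` a function of the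
  centre links only, whence **a multiplicative oscillation bound `q(U) ≤ e^{A} q(U')` for the data `σ ∈ S` yields
  `BlockedRepOn ρ β w Y (e^{A} − 1) S`** — the W-class (and every W|Typ class) from centre-cell RATIO mixing; and
  `Theorems/IR/BlockedActivityWStrongCouplingMesh` proves that bound at strong coupling `216·N·|β| ≤ 1` at EVERY mesh `b` with
  `A ≍ b⁴·2^{−2nb}` (Dobrushin), i.e. the class of record at every large mesh uniformly in the strong window — against the `b⁻⁴`
  re-indexing window of `BlockedActivityCalibrationMesh` (p541588).

HONEST FRAMING: a format theorem (dictionary) about the lane's OWN currency; nothing here asserts weak-coupling mixing of 4-d Yang–Mills,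
a gap or Clay.  No `sorry`; axioms ⊆ {propext, Classical.choice, Quot.sound}; no instances, no notation.
Refs: Georgii 2011 Def. 1.23, proof of Prop. 8.8 (tilts of one measure); Chatterjee CMP 385 (2021) §7 eq. (7.2), Lemma 7.3;
Dobrushin–Shlosman 1985/1987 (ratio ∕ complete-analyticity mixing conditions); FriedliVelenik2017 §5.7.1.
-/

set_option autoImplicit false

noncomputable section

open MeasureTheory ProbabilityTheory
open Literature.MathematicalPhysics.QuantumLattice
open Literature.Probability.LatticeModels
open Summit.QuantumFields.YangMills.Cruxes.IR.Tempered (cellEdges windowCells regionEdges collarEdges)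

namespace Summit.QuantumFields.YangMills.Cruxes.IR.BlockedActivity

/-! ## §1 The single-cell tilt representation (the finite-range axiom idles) -/

section SingleCellSigma

variable {G : Type} [MeasurableSpace G] {a : ℝ}

open Classical in
/-- The cell σ-algebras of the single-cell representation: the full σ-algebra at the centre cell, the trivial one elsewhere. -/
@[reducible] def singleCellSigma (G : Type) [MeasurableSpace G] (c : Cell) : MeasurableSpace (LGConfig 4 G) :=
  if c = 0 then MeasurableSpace.pi else ⊥

open Classical in
/-- The cell factors of the single-cell representation: `g₀` at the centre cell, `0` elsewhere. -/
def singleCellFactor (g₀ : LGConfig 4 G → ℂ) (c : Cell) : LGConfig 4 G → ℂ :=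
  if c = 0 then g₀ else fun _ => 0

/-- At the centre the single-cell σ-algebra is the ambient one. -/
theorem singleCellSigma_zero : singleCellSigma G 0 = (MeasurableSpace.pi : MeasurableSpace (LGConfig 4 G)) := by
  simp [singleCellSigma]

/-- Off the centre the single-cell σ-algebra is trivial. -/
theorem singleCellSigma_of_ne {c : Cell} (hc : c ≠ 0) : singleCellSigma G c = ⊥ := by
  simp [singleCellSigma, hc]

/-- The σ-algebra generated by a cell set avoiding the centre is trivial. -/
theorem iSup_singleCellSigma_eq_bot {K : Finset Cell} (hK : (0 : Cell) ∉ K) :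
    (⨆ p ∈ K, singleCellSigma G p) = ⊥ := by
  refine iSup_eq_bot.2 fun p => iSup_eq_bot.2 fun hp => ?_
  exact singleCellSigma_of_ne (fun h => hK (h ▸ hp))

/-- **The finite-range axiom idles for one informative cell.**  For ANY probability measure `μ` on the configuration space and any
measurable `g₀` with `‖g₀‖ ≤ a`, the family «`g₀` at the centre, `0` elsewhere» is a local perturbation of `μ` of radius `a` for the
single-cell σ-algebras: two cell sets that do not touch cannot both contain the centre, and the trivial σ-algebra is independent of
everything (Mathlib `indep_bot_left ∕ right`). -/
theorem isLocalPerturbation_singleCell (μ : Measure (LGConfig 4 G)) [IsProbabilityMeasure μ]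
    {g₀ : LGConfig 4 G → ℂ} (hg : Measurable g₀) (ha : ∀ U, ‖g₀ U‖ ≤ a) (ha0 : 0 ≤ a) :
    IsLocalPerturbation μ CellAdj (singleCellSigma G) (singleCellFactor g₀) a where
  le p := by
    by_cases hp : p = 0
    · subst hp; rw [singleCellSigma_zero]
    · rw [singleCellSigma_of_ne hp]; exact bot_le
  indep K₁ K₂ hK := by
    by_cases h1 : (0 : Cell) ∈ K₁
    · by_cases h2 : (0 : Cell) ∈ K₂
      · exact absurd ⟨0, h1, 0, h2, Or.inl rfl⟩ hK
      · rw [iSup_singleCellSigma_eq_bot h2]; exact indep_bot_right _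
    · rw [iSup_singleCellSigma_eq_bot h1]; exact indep_bot_left _
  measurable p := by
    by_cases hp : p = 0
    · subst hp
      simp only [singleCellFactor, if_true]
      exact hg.mono (le_of_eq singleCellSigma_zero.symm) le_rfl
    · simp only [singleCellFactor, hp, if_false]
      exact measurable_const
  norm_le p U := by
    by_cases hp : p = 0
    · subst hp; simp only [singleCellFactor, if_true]; exact ha U
    · simp only [singleCellFactor, hp, if_false, norm_zero]; exact ha0
  nonneg := ha0

end SingleCellSigma

section SingleCell

variable {G : Type} [Group G] [TopologicalSpace G] [IsTopologicalGroup G] [CompactSpace G]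
  [MeasurableSpace G] [BorelSpace G] {N : ℕ} {ρ : G →* Matrix (Fin N) (Fin N) ℂ} {β : ℝ}
  {w : Fin 4 → ℤ → ℤ} {Y : Finset Cell} {a : ℝ} {S : Set (LGConfig 4 G)}

/-- **The single-cell tilt representation.**  If, for every datum `σ ∈ S`, the kernel expectations of centre observables are an
EXACT multiplicative tilt of one probability measure `μ` on the configuration space — `∫ f dγ_σ = ∫ f ψ_σ dμ ∕ ∫ ψ_σ dμ` with `ψ_σ`
measurable and `sup |ψ_σ − 1| ≤ a` — then `BlockedRepOn ρ β w Y a S` holds: `Ω` = configurations, reference `μ`, one informative cell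
(`singleCellSigma`), `C = {0}`, `g σ 0 = ψ_σ − 1`, `obs f = f`.  (No smallness of `a` and no property of `μ` beyond total mass `1` is
used: the class asks nothing of the cells `c ≠ 0`.) -/
def blockedRepOn_of_tilt (μ : Measure (LGConfig 4 G)) [IsProbabilityMeasure μ] (ψ : LGConfig 4 G → LGConfig 4 G → ℝ)
    (ha0 : 0 ≤ a) (hψm : ∀ σ ∈ S, Measurable (ψ σ)) (hψa : ∀ σ ∈ S, ∀ U, |ψ σ U - 1| ≤ a)
    (hrep : ∀ σ ∈ S, ∀ f : LGConfig 4 G → ℝ, IsCentreObs w f →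
      ∫ U, f U ∂(ymSpecification ρ β (regionEdges w Y) σ) = (∫ U, f U * ψ σ U ∂μ) / ∫ U, ψ σ U ∂μ) :
    BlockedRepOn ρ β w Y a S where
  Ω := LGConfig 4 G
  mΩ := MeasurableSpace.pi
  μ := μ
  isProb := inferInstance
  𝓕 := singleCellSigma G
  C := {0}
  g σ := singleCellFactor fun U => ((ψ σ U - 1 : ℝ) : ℂ)
  obs f U := (f U : ℂ)
  perturbation σ hσ :=
    isLocalPerturbation_singleCell μ (Complex.measurable_ofReal.comp ((hψm σ hσ).sub measurable_const))
      (fun U => by rw [Complex.norm_real, Real.norm_eq_abs]; exact hψa σ hσ U) ha0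
  obs_local f hf := by
    refine ⟨?_, fun U => ?_⟩
    · have hle : singleCellSigma G 0 ≤ ⨆ p ∈ ({0} : Finset Cell), singleCellSigma G p :=
        le_iSup₂ (f := fun p (_ : p ∈ ({0} : Finset Cell)) => singleCellSigma G p) 0 (Finset.mem_singleton_self 0)
      rw [singleCellSigma_zero] at hle
      exact (Complex.measurable_ofReal.comp hf.2.1).mono hle le_rfl
    · rw [Complex.norm_real, Real.norm_eq_abs, abs_le]
      exact ⟨by linarith [(hf.2.2 U).1], (hf.2.2 U).2⟩
  rep σ hσ f hf := by
    have hnum : pertNum μ (singleCellFactor fun U => ((ψ σ U - 1 : ℝ) : ℂ)) (fun U => (f U : ℂ)) {0} =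
        ((∫ U, f U * ψ σ U ∂μ : ℝ) : ℂ) := by
      unfold pertNum
      rw [← integral_complex_ofReal]
      refine integral_congr_ae (ae_of_all _ fun U => ?_)
      simp only [Finset.prod_singleton, singleCellFactor, if_true]
      push_cast
      ring
    have hden : pertZ μ (singleCellFactor fun U => ((ψ σ U - 1 : ℝ) : ℂ)) {0} = ((∫ U, ψ σ U ∂μ : ℝ) : ℂ) := by
      unfold pertZ
      rw [← integral_complex_ofReal]
      refine integral_congr_ae (ae_of_all _ fun U => ?_)
      simp only [Finset.prod_singleton, singleCellFactor, if_true]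
      push_cast
      ring
    rw [pertExpect, hnum, hden, ← Complex.ofReal_div, hrep σ hσ f hf]

end SingleCell

/-! ## §2 The change-of-exterior identity for the Wilson kernels (arbitrary pair of exteriors) -/

section Splice

variable {d : ℕ} {G : Type}

/-- Splice: the configuration equal to `V` on `Λ₀` and to `σ` off `Λ₀` (the tree's `glueWith` fed with the restriction of `V`). -/
def splice (Λ₀ : Finset (ZdEdge d)) (V σ : LGConfig d G) : LGConfig d G :=
  glueWith Λ₀ (fun e : ↥Λ₀ => V e) σ

/-- On `Λ₀` the splice reads `V`. -/
theorem splice_apply_mem (Λ₀ : Finset (ZdEdge d)) (V σ : LGConfig d G) {e : ZdEdge d} (he : e ∈ Λ₀) :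
    splice Λ₀ V σ e = V e := by
  simp [splice, glueWith_apply_mem _ _ _ he]

/-- Off `Λ₀` the splice reads `σ`. -/
theorem splice_apply_not_mem (Λ₀ : Finset (ZdEdge d)) (V σ : LGConfig d G) {e : ZdEdge d} (he : e ∉ Λ₀) :
    splice Λ₀ V σ e = σ e := by
  simp [splice, glueWith_apply_not_mem _ _ _ he]

/-- Splicing a glued configuration replaces its exterior. -/
theorem splice_glueWith (Λ₀ : Finset (ZdEdge d)) (u : ↥Λ₀ → G) (η σ : LGConfig d G) :
    splice Λ₀ (glueWith Λ₀ u η) σ = glueWith Λ₀ u σ := by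
  funext e
  by_cases he : e ∈ Λ₀
  · rw [splice_apply_mem _ _ _ he, glueWith_apply_mem _ _ _ he, glueWith_apply_mem _ _ _ he]
  · rw [splice_apply_not_mem _ _ _ he, glueWith_apply_not_mem _ _ _ he]

/-- The splice depends on `V` only through `Λ₀`. -/
theorem splice_eq_of_eqOn (Λ₀ : Finset (ZdEdge d)) {V V' : LGConfig d G} (σ : LGConfig d G) (h : ∀ e ∈ Λ₀, V e = V' e) :
    splice Λ₀ V σ = splice Λ₀ V' σ := by
  funext e
  by_cases he : e ∈ Λ₀
  · rw [splice_apply_mem _ _ _ he, splice_apply_mem _ _ _ he, h e he]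
  · rw [splice_apply_not_mem _ _ _ he, splice_apply_not_mem _ _ _ he]

/-- A configuration equal to `σ` off `Λ₀` is its own splice. -/
theorem splice_eq_self (Λ₀ : Finset (ZdEdge d)) {V σ : LGConfig d G} (h : ∀ e ∉ Λ₀, V e = σ e) : splice Λ₀ V σ = V := by
  funext e
  by_cases he : e ∈ Λ₀
  · rw [splice_apply_mem _ _ _ he]
  · rw [splice_apply_not_mem _ _ _ he, h e he]

/-- The splice is measurable in `V`. -/
theorem measurable_splice [MeasurableSpace G] (Λ₀ : Finset (ZdEdge d)) (σ : LGConfig d G) : Measurable fun V : LGConfig d G => splice Λ₀ V σ :=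
  (measurable_glueWith Λ₀ σ).comp (measurable_pi_lambda _ fun e : ↥Λ₀ => measurable_pi_apply (e : ZdEdge d))

/-- The splice is continuous in `V`. -/
theorem continuous_splice [TopologicalSpace G] (Λ₀ : Finset (ZdEdge d)) (σ : LGConfig d G) : Continuous fun V : LGConfig d G => splice Λ₀ V σ := by
  refine continuous_pi fun e => ?_
  by_cases he : e ∈ Λ₀
  · simp only [splice_apply_mem _ _ _ he]; exact continuous_apply e
  · simp only [splice_apply_not_mem _ _ _ he]; exact continuous_const

end Splice

section ChangeOfExterior

variable {d : ℕ} {G : Type} [Group G] {N : ℕ} (ρ : G →* Matrix (Fin N) (Fin N) ℂ)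

/-- **The boundary Boltzmann ratio** of the exterior pair `(σ₁, σ₂)` for the volume `Λ₀`:
`R(V) = exp(−β [S_{Λ₀}(V|_{Λ₀} ∨ σ₁) − S_{Λ₀}(V|_{Λ₀} ∨ σ₂)])` — the density of the `σ₁`-kernel against the `σ₂`-kernel up to
normalisation (`integral_ymSpecification_eq_div_bcRatio`). -/
def bcRatio (β : ℝ) (Λ₀ : Finset (ZdEdge d)) (σ₁ σ₂ : LGConfig d G) (V : LGConfig d G) : ℝ :=
  Real.exp (-β * (wilsonBoundaryAction ρ Λ₀ (splice Λ₀ V σ₁) - wilsonBoundaryAction ρ Λ₀ (splice Λ₀ V σ₂)))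

/-- The boundary Boltzmann ratio is positive. -/
theorem bcRatio_pos (β : ℝ) (Λ₀ : Finset (ZdEdge d)) (σ₁ σ₂ V : LGConfig d G) : 0 < bcRatio ρ β Λ₀ σ₁ σ₂ V :=
  Real.exp_pos _

/-- The boundary Boltzmann ratio reads only the links of `Λ₀`. -/
theorem bcRatio_eq_of_eqOn (β : ℝ) (Λ₀ : Finset (ZdEdge d)) (σ₁ σ₂ : LGConfig d G) {V V' : LGConfig d G}
    (h : ∀ e ∈ Λ₀, V e = V' e) : bcRatio ρ β Λ₀ σ₁ σ₂ V = bcRatio ρ β Λ₀ σ₁ σ₂ V' := by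
  simp only [bcRatio, splice_eq_of_eqOn Λ₀ σ₁ h, splice_eq_of_eqOn Λ₀ σ₂ h]

variable [TopologicalSpace G] [IsTopologicalGroup G]

/-- The boundary Boltzmann ratio is continuous for a continuous representation. -/
theorem continuous_bcRatio (hρ : Continuous ρ) (β : ℝ) (Λ₀ : Finset (ZdEdge d)) (σ₁ σ₂ : LGConfig d G) :
    Continuous (bcRatio ρ β Λ₀ σ₁ σ₂) :=
  Real.continuous_exp.comp (continuous_const.mul
    (((continuous_wilsonBoundaryAction ρ hρ Λ₀).comp (continuous_splice Λ₀ σ₁)).sub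
      ((continuous_wilsonBoundaryAction ρ hρ Λ₀).comp (continuous_splice Λ₀ σ₂))))

/-- The boundary Boltzmann ratio is measurable. -/
theorem measurable_bcRatio [MeasurableSpace G] [BorelSpace G] [SecondCountableTopology G] (hρ : Continuous ρ) (β : ℝ)
    (Λ₀ : Finset (ZdEdge d)) (σ₁ σ₂ : LGConfig d G) : Measurable (bcRatio ρ β Λ₀ σ₁ σ₂) :=
  (continuous_bcRatio ρ hρ β Λ₀ σ₁ σ₂).measurable

/-- The boundary Boltzmann ratio is bounded (continuity on a compact configuration space). -/
theorem exists_bcRatio_le [CompactSpace G] (hρ : Continuous ρ) (β : ℝ) (Λ₀ : Finset (ZdEdge d)) (σ₁ σ₂ : LGConfig d G) :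
    ∃ B : ℝ, ∀ V, |bcRatio ρ β Λ₀ σ₁ σ₂ V| ≤ B :=
  exists_bound_of_continuous (continuous_bcRatio ρ hρ β Λ₀ σ₁ σ₂)

variable [CompactSpace G] [MeasurableSpace G] [BorelSpace G]

/-- **Change-of-exterior identity** (finite form of Chatterjee 2021 eq. (7.2) for an arbitrary pair of exteriors; the tree's
`integral_ymSpecification_update_eq` is the one-link case): for the Wilson kernel of a finite link set `Λ₀` and every measurable `F`
not distinguishing the two gluings, `∫ F dγ_{Λ₀}(·|σ₁) = ∫ F·R dγ_{Λ₀}(·|σ₂) ∕ ∫ R dγ_{Λ₀}(·|σ₂)`, `R = bcRatio ρ β Λ₀ σ₁ σ₂`.  Proof: both kernels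
are the glued product Haar measure tilted by `−β S_{Λ₀} ∘ glue`; the `σ₁`-exponent is the `σ₂`-exponent plus `log R ∘ glue_{σ₂}`, and
Mathlib's `tilted_tilted` ∕ `integral_tilted` give the quotient. -/
theorem integral_ymSpecification_eq_div_bcRatio [SecondCountableTopology G] (hρ : Continuous ρ) (β : ℝ) (Λ₀ : Finset (ZdEdge d))
    (σ₁ σ₂ : LGConfig d G) {F : LGConfig d G → ℝ} (hFm : Measurable F)
    (hF : ∀ u : ↥Λ₀ → G, F (glueWith Λ₀ u σ₁) = F (glueWith Λ₀ u σ₂)) :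
    ∫ U, F U ∂(ymSpecification ρ β Λ₀ σ₁) =
      (∫ U, F U * bcRatio ρ β Λ₀ σ₁ σ₂ U ∂(ymSpecification ρ β Λ₀ σ₂)) /
        ∫ U, bcRatio ρ β Λ₀ σ₁ σ₂ U ∂(ymSpecification ρ β Λ₀ σ₂) := by
  classical
  set π : Measure (↥Λ₀ → G) := Measure.pi fun _ : ↥Λ₀ => Literature.MathematicalPhysics.QuantumFieldTheory.haarProbability G with hπ
  set Φ : LGConfig d G → ℝ := fun U => -β * wilsonBoundaryAction ρ Λ₀ U with hΦ
  set δ : LGConfig d G → ℝ := fun U =>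
    -β * (wilsonBoundaryAction ρ Λ₀ (splice Λ₀ U σ₁) - wilsonBoundaryAction ρ Λ₀ (splice Λ₀ U σ₂)) with hδ
  have hΦm : Measurable Φ := (continuous_const.mul (continuous_wilsonBoundaryAction ρ hρ Λ₀)).measurable
  have hδm : Measurable δ := (continuous_const.mul
    (((continuous_wilsonBoundaryAction ρ hρ Λ₀).comp (continuous_splice Λ₀ σ₁)).sub
      ((continuous_wilsonBoundaryAction ρ hρ Λ₀).comp (continuous_splice Λ₀ σ₂)))).measurable
  -- the two pulled-back exponents differ by `δ ∘ glue_{σ₂}`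
  have hexp : (Φ ∘ fun u : ↥Λ₀ → G => glueWith Λ₀ u σ₁) =
      (Φ ∘ fun u : ↥Λ₀ → G => glueWith Λ₀ u σ₂) + (δ ∘ fun u : ↥Λ₀ → G => glueWith Λ₀ u σ₂) := by
    funext u
    simp only [Function.comp_apply, Pi.add_apply, hΦ, hδ, splice_glueWith]
    ring
  -- integrability of the `σ₂`-Boltzmann factor on `π`
  have hbdd : ∃ B, ∀ U : LGConfig d G, |Φ U| ≤ B := exists_bound_of_continuous
    (continuous_const.mul (continuous_wilsonBoundaryAction ρ hρ Λ₀))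
  have hint : Integrable (fun u : ↥Λ₀ → G => Real.exp ((Φ ∘ fun u => glueWith Λ₀ u σ₂) u)) π := by
    obtain ⟨B, hB⟩ := hbdd
    exact integrable_exp_of_abs_le π (hΦm.comp (measurable_glueWith Λ₀ σ₂)) ⟨B, fun u => hB _⟩
  -- unfold the two kernels as tilts of `π`
  have hL : ∫ U, F U ∂(ymSpecification ρ β Λ₀ σ₁) =
      ∫ u, F (glueWith Λ₀ u σ₁) ∂(π.tilted (Φ ∘ fun u => glueWith Λ₀ u σ₁)) :=
    integral_tilted_map_eq_integral_tilted_comp π (measurable_glueWith Λ₀ _) hΦm hFm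
  have hR : ∀ {H : LGConfig d G → ℝ}, Measurable H →
      ∫ U, H U ∂(ymSpecification ρ β Λ₀ σ₂) = ∫ u, H (glueWith Λ₀ u σ₂) ∂(π.tilted (Φ ∘ fun u => glueWith Λ₀ u σ₂)) :=
    fun hH => integral_tilted_map_eq_integral_tilted_comp π (measurable_glueWith Λ₀ _) hΦm hH
  have hEm : Measurable fun U : LGConfig d G => Real.exp (δ U) := hδm.exp
  have hbc : (bcRatio ρ β Λ₀ σ₁ σ₂) = fun U => Real.exp (δ U) := rfl
  rw [hbc, hL, hR (H := fun U => F U * Real.exp (δ U)) (hFm.mul hEm), hR hEm, hexp, ← tilted_tilted hint, integral_tilted]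
  simp only [Function.comp_apply, hF, smul_eq_mul]
  rw [← integral_div]
  refine integral_congr_ae (ae_of_all _ fun u => ?_)
  ring

end ChangeOfExterior

end Summit.QuantumFields.YangMills.Cruxes.IR.BlockedActivity

end
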